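import Literature.AnabelianGeometry.SemiGraphs.PSCUnrVerticialSeparatingCoveringsThreeChain
import HarnessLib

/-!
# [CombGC] Prop. 1.2, proof p. 9: the `Π^unr`-VERTICIAL separating coverings at THREE-COMPONENT CHAINS pointed on every component (row F-2828)

Mochizuki, *A combinatorial version of the Grothendieck conjecture*, Tohoku Math. J. **59** (2007)
[CombGC], PROOF of Prop. 1.2, p. 9 ("under the further assumption that `G` is sturdy … there exists a
finite étale `Π^unr_G`-covering `G' → G` whose restriction to the anabelioid `G_{v₂}` is trivial, but whose
restriction to `G_{v₁}` is nontrivial") [cite: MochizukiCombGC2007, Prop 1.2 proof p.9]; typed LEVEL-WISE by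
abc-iut-w4-d081 as `PSCDatum.UnrVerticialSeparatingCoverings` (row P12-L01-U; abc-iut FACT-LIST row F-2828, the
`Π^unr` conjunct of F-2829 / F-2830 — a schema whose universal closure is refuted as typed; the instance forms
at genuine carriers are the content), with the sturdy `Π^unr`-clauses of Prop. 1.2 (i)(ii)
(`UnrVerticialOpenInterDeterminesVertex`, `UnrVerticialCommensurablyTerminal`) by abc-iut-w5-d183's formal steps.

PROOF-ONLY file (abc-iut-f-166 gen 6, row «POINTED-CHAIN», file 3; 0 definitions).  abc-iut-f-164's
`unrVerticialSeparatingCoverings_of_threeChain` (`PSCUnrVerticialSeparatingCoveringsThreeChain.lean`) carries the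
cusp bounds `2 ≤ s₁`, `s₁ + 2 ≤ s₂`, `s₂ + 2 ≤ r` of its gen-3 chain shape, but its PROOF uses them at exactly
one place: the distinctness `ν_A ≠ ν_B` of the two nodes, read off gen 3's free-factor package (which needs the
spare marked points for Prop. 1.5).  Here that step is replaced by a direct argument — the continuous extension
of the cusp character `δ_{s₂} − δ_{s₁}` mod `ℓ` (`ℓ ∈ Σ`) kills `cl ι⟨η⟩` but not `ι(ε_A)`, so the two node
groups differ — and the rest of abc-iut-f-164's proof (the `Π^unr`-quotient `Γ/⟨⟨c_j, ε_A, η⟩⟩ ≅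
Γ_{g₀,0} ∗ Γ_{g₁−g₀,0} ∗ Γ_{g−g₁,0}` in three orientations, fibred twist / projection at the discrete level,
abc-iut-w5-d047's transfer) runs VERBATIM under the relaxed bounds `s₁ < s₂ < r` (every component marked,
possibly by a single point); credit for the proof body: abc-iut-f-164 gen 4.

* `unrVerticialSeparatingCoverings_of_threeChain'` — **F-2828** (`V' := V`) at EVERY pointed three-chain datum;
* `unrProp12_of_threeChain'` — the sturdy `Π^unr`-clauses of Prop. 1.2 (i) and (ii) there.

A shape instance is consistency evidence for the typed schemata, not the printed statement for all pointed
stable curves (cell FOUNDATIONS rows 13–14).  Nothing here takes a side on [IUTchIII] Cor. 3.12.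
-/

noncomputable section

namespace Literature.AnabelianGeometry.SemiGraphs

namespace PSCDatum

open scoped Pointwise
open Literature.AnabelianGeometry.Anabelioids (IsSigmaInteger)
open Literature.GroupTheory.CombinatorialGroupTheory
open Monoid (Coprod)
open SemiGraphOfAnabelioids (IsProSigmaCompletion)
open Multiplicative (ofAdd)
open SemiGraphOfAnabelioids.IsProSigmaCompletion (exists_open_unrSeparating_same
  exists_open_unrSeparating_cross finiteIndex_comap)
open Literature.GroupTheory.CombinatorialGroupTheory.PuncturedSurfaceGroup (a b c cuspInertia
  exists_coprod_chain_pinned map_mk_closure_v0_eq_range map_mk_closure_chainMid_eq_range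
  map_mk_closure_chainLast_eq_range exists_handleCharacter_pow_ne_one)

variable {P : Type} [Group P] [TopologicalSpace P] [IsTopologicalGroup P]
variable [CompactSpace P] [TotallyDisconnectedSpace P] {Sigma : Set ℕ} {g r : ℕ}

/-- **Row P12-L01-U (`UnrVerticialSeparatingCoverings`, F-2828) at the THREE-COMPONENT CHAIN data pointed on
every component** (`s₁ < s₂ < r`), sturdy or not (`V' := V`): distinct vertices `(w₁, Vγ₁(Π_{w₁}·Ker)) ≠ (w₂, Vγ₂(Π_{w₂}·Ker))` of the
`Π^unr`-covering `G_V` are separated by an open `U ≤ V`, normal in `V`, with `(γ₂Π_{w₂}γ₂⁻¹ · Ker) ∩ V ≤ U` and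
`γ₁Π_{w₁}γ₁⁻¹ ∩ V ⊄ U`.  Sturdiness (the antecedent) enters through the genus pins; witness `a^{[Γ:ι⁻¹V]}` for
the first handle of the alive component; fibred twist (same vertex) resp. projection (different vertices) in
`Γ/⟨⟨c_j, ε_A, η⟩⟩ ≅ Γ_{g₀,0} ∗ Γ_{g₁−g₀,0} ∗ Γ_{g−g₁,0}`. [cite: MochizukiCombGC2007, Prop 1.2 proof p.9] -/
theorem unrVerticialSeparatingCoverings_of_threeChain' (hne : Sigma.Nonempty)
    (hprime : ∀ p ∈ Sigma, p.Prime) (ι : PuncturedSurfaceGroup g r →* P)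
    (hι : IsProSigmaCompletion Sigma ι) (G : PSCDatum P) {g₀ g₁ s₁ s₂ : ℕ} (hg : g₀ ≤ g₁) (hg₁ : g₁ ≤ g)
    (hs₁₂ : s₁ < s₂) (hs₂ : s₂ < r) (e : G.graph.C ≃ Fin r)
    (hC : ∀ c', G.cuspGp c' = ((cuspInertia (g := g) (e c')).map ι).topologicalClosure)
    (v₀ vm v₁ : G.graph.V) (hV : ∀ w, w = v₀ ∨ w = vm ∨ w = v₁) (εA η : PuncturedSurfaceGroup g r)
    (hεA : εA = ((List.finRange r).map fun j : Fin r =>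
          if s₂ ≤ (j : ℕ) then PuncturedSurfaceGroup.c (g := g) j else 1).prod *
        ((List.finRange g).map fun i : Fin g => if (i : ℕ) < g₀ then
          PuncturedSurfaceGroup.a (r := r) i * PuncturedSurfaceGroup.b i *
            (PuncturedSurfaceGroup.a i)⁻¹ * (PuncturedSurfaceGroup.b i)⁻¹ else 1).prod)
    (hη : η = ((List.finRange r).map fun j : Fin r =>
          if s₁ ≤ (j : ℕ) then PuncturedSurfaceGroup.c (g := g) j else 1).prod *
        ((List.finRange g).map fun i : Fin g => if (i : ℕ) < g₁ then
          PuncturedSurfaceGroup.a (r := r) i * PuncturedSurfaceGroup.b i *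
            (PuncturedSurfaceGroup.a i)⁻¹ * (PuncturedSurfaceGroup.b i)⁻¹ else 1).prod)
    (hV₀ : G.vertGp v₀ = ((Subgroup.closure {x : PuncturedSurfaceGroup g r |
        (∃ i : Fin g, (i : ℕ) < g₀ ∧ (x = PuncturedSurfaceGroup.a i ∨ x = PuncturedSurfaceGroup.b i)) ∨
        ∃ j : Fin r, s₂ ≤ (j : ℕ) ∧ x = PuncturedSurfaceGroup.c j}).map ι).topologicalClosure)
    (hVm : G.vertGp vm = ((Subgroup.closure {x : PuncturedSurfaceGroup g r |
        (∃ i : Fin g, (g₀ ≤ (i : ℕ) ∧ (i : ℕ) < g₁) ∧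
          (x = PuncturedSurfaceGroup.a i ∨ x = PuncturedSurfaceGroup.b i)) ∨
        (∃ j : Fin r, (s₁ ≤ (j : ℕ) ∧ (j : ℕ) < s₂) ∧ x = PuncturedSurfaceGroup.c j) ∨
        x = εA ∨ x = η}).map ι).topologicalClosure)
    (hV₁ : G.vertGp v₁ = ((Subgroup.closure {x : PuncturedSurfaceGroup g r |
        (∃ i : Fin g, g₁ ≤ (i : ℕ) ∧ (x = PuncturedSurfaceGroup.a i ∨ x = PuncturedSurfaceGroup.b i)) ∨
        (∃ j : Fin r, (j : ℕ) < s₁ ∧ x = PuncturedSurfaceGroup.c j) ∨ x = η}).map ι).topologicalClosure)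
    (nA nB : G.graph.N) (hN : ∀ n, n = nA ∨ n = nB)
    (hEA : G.nodeGp nA = ((Subgroup.zpowers εA).map ι).topologicalClosure)
    (hEB : G.nodeGp nB = ((Subgroup.zpowers η).map ι).topologicalClosure)
    (hgen₀ : G.genus v₀ = g₀) (hgenm : G.genus vm = g₁ - g₀) (hgen₁ : G.genus v₁ = g - g₁) :
    G.UnrVerticialSeparatingCoverings := by
  classical
  -- the two nodes are distinct: `cl ι⟨η⟩ ≠ cl ι⟨ε_A⟩`, detected by the character `δ_{s₂} − δ_{s₁}` mod `ℓ`
  have hAB : nA ≠ nB := by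
    classical
    obtain ⟨ℓ, hℓS⟩ := hne
    have hℓ : ℓ.Prime := hprime ℓ hℓS
    haveI : NeZero ℓ := ⟨hℓ.ne_zero⟩
    haveI : Fact (1 < ℓ) := ⟨hℓ.one_lt⟩
    obtain ⟨χ, -, -, hχc⟩ := PuncturedSurfaceGroup.exists_handleCuspCharacter (g := g) (r := r) (n := ℓ)
      (fun _ => 0) (fun _ => 0)
      (fun j => (if j = ⟨s₂, by omega⟩ then (1 : ZMod ℓ) else 0) + (if j = ⟨s₁, by omega⟩ then (-1 : ZMod ℓ) else 0))
      (TwoComponentAffine.sum_twoDelta _ _)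
    have hχη : χ η = 1 := by
      rw [hη, TwoComponentAffine.character_nodeLoop χ hχc g₁ s₁, TwoComponentAffine.sum_ite_twoDelta,
        if_pos (show s₁ ≤ ((⟨s₂, _⟩ : Fin r) : ℕ) by simp only; omega),
        if_pos (show s₁ ≤ ((⟨s₁, _⟩ : Fin r) : ℕ) from le_rfl), add_neg_cancel, ofAdd_zero]
    have hχA : χ εA ≠ 1 := by
      rw [hεA, TwoComponentAffine.character_nodeLoop χ hχc g₀ s₂, TwoComponentAffine.sum_ite_twoDelta,
        if_pos (show s₂ ≤ ((⟨s₂, _⟩ : Fin r) : ℕ) from le_rfl),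
        if_neg (show ¬ s₂ ≤ ((⟨s₁, _⟩ : Fin r) : ℕ) by simp only; omega), add_zero]
      intro h
      have h1 : (1 : ZMod ℓ) = 0 := Multiplicative.ofAdd.injective (h.trans ofAdd_zero.symm)
      exact one_ne_zero h1
    intro hABeq
    -- the continuous extension of `χ` kills `cl ι⟨η⟩ = Π_{nB} = Π_{nA} ∋ ι ε_A`
    letI : TopologicalSpace (Multiplicative (ZMod ℓ)) := ⊥
    haveI : DiscreteTopology (Multiplicative (ZMod ℓ)) := ⟨rfl⟩
    have hQ : IsSigmaInteger Sigma (Nat.card (Multiplicative (ZMod ℓ))) := by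
      rw [show Nat.card (Multiplicative (ZMod ℓ)) = ℓ from Nat.card_zmod ℓ]
      exact ⟨hℓ.pos, fun q hq hdvd => by rwa [(Nat.prime_dvd_prime_iff_eq hq hℓ).mp hdvd]⟩
    obtain ⟨F, hFc, hF⟩ := SemiGraphOfAnabelioids.IsProSigmaCompletion.exists_continuous_extend_top hι hQ χ
    have hkerc : IsClosed ((F.ker : Subgroup P) : Set P) := by
      have hker : ((F.ker : Subgroup P) : Set P) = F ⁻¹' {1} := by
        ext x
        simp only [SetLike.mem_coe, MonoidHom.mem_ker, Set.mem_preimage, Set.mem_singleton_iff]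
      rw [hker]
      exact (isClosed_discrete _).preimage hFc
    have hle : ((Subgroup.zpowers η).map ι).topologicalClosure ≤ F.ker := by
      refine Subgroup.topologicalClosure_minimal _ ?_ hkerc
      rintro _ ⟨x, hx, rfl⟩
      obtain ⟨k, rfl⟩ := Subgroup.mem_zpowers_iff.mp hx
      rw [MonoidHom.mem_ker, hF, map_zpow, hχη, one_zpow]
    have hmem : ι εA ∈ ((Subgroup.zpowers η).map ι).topologicalClosure := by
      rw [← hEB, ← hABeq, hEA]
      exact Subgroup.le_topologicalClosure _ (Subgroup.mem_map_of_mem ι (Subgroup.mem_zpowers εA))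
    have := hle hmem
    rw [MonoidHom.mem_ker, hF] at this
    exact hχA this
  intro hst V hVn hVo
  haveI := hVn
  have h0 : 2 ≤ g₀ := hgen₀ ▸ hst v₀
  have hm' : 2 ≤ g₁ - g₀ := hgenm ▸ hst vm
  have h1' : 2 ≤ g - g₁ := hgen₁ ▸ hst v₁
  obtain ⟨gm, rfl⟩ : ∃ gm, g₁ = g₀ + gm := ⟨g₁ - g₀, by omega⟩
  obtain ⟨g2, rfl⟩ : ∃ g2, g = g₀ + (gm + g2) := ⟨g - (g₀ + gm), by omega⟩
  have hgm : 2 ≤ gm := by omega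
  have hg2 : 2 ≤ g2 := by omega
  obtain ⟨ℓ, hℓS⟩ := hne
  have hℓ : ℓ.Prime := hprime ℓ hℓS
  set K : Subgroup (PuncturedSurfaceGroup (g₀ + (gm + g2)) r) :=
    Subgroup.normalClosure ({εA, η} ∪ Set.range (c : Fin r → PuncturedSurfaceGroup (g₀ + (gm + g2)) r))
    with hKdef
  have hcK : ∀ j, c j ∈ K := fun j => Subgroup.subset_normalClosure (Or.inr ⟨j, rfl⟩)
  have hεK : εA ∈ K := Subgroup.subset_normalClosure (Or.inl (Set.mem_insert _ _))
  have hηK : η ∈ K := Subgroup.subset_normalClosure (Or.inl (Set.mem_insert_of_mem _ rfl))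
  have hKer : G.unrKer = (K.map ι).topologicalClosure := by
    let xs : G.graph.N ⊕ G.graph.C → PuncturedSurfaceGroup (g₀ + (gm + g2)) r :=
      Sum.elim (fun n => if n = nA then εA else η) fun c' => c (e c')
    have hx : ∀ e', G.edgeGp e' = ((Subgroup.zpowers (xs e')).map ι).topologicalClosure := by
      rintro (n | c')
      · change G.nodeGp n = ((Subgroup.zpowers (if n = nA then εA else η)).map ι).topologicalClosure
        rcases hN n with rfl | rfl
        · rw [if_pos rfl, hEA]
        · rw [if_neg (Ne.symm hAB), hEB]
      · exact hC c'
    have hrange : Set.range xs = {εA, η} ∪ Set.range (c : Fin r → PuncturedSurfaceGroup (g₀ + (gm + g2)) r) := by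
      ext x
      simp only [xs, Set.mem_range, Set.mem_union, Set.mem_insert_iff, Set.mem_singleton_iff, Sum.exists,
        Sum.elim_inl, Sum.elim_inr]
      constructor
      · rintro (⟨n, rfl⟩ | ⟨c', rfl⟩)
        · by_cases h : n = nA
          · exact Or.inl (Or.inl (by rw [if_pos h]))
          · exact Or.inl (Or.inr (by rw [if_neg h]))
        · exact Or.inr ⟨e c', rfl⟩
      · rintro ((rfl | rfl) | ⟨j, rfl⟩)
        · exact Or.inl ⟨nA, by rw [if_pos rfl]⟩
        · exact Or.inl ⟨nB, by rw [if_neg (Ne.symm hAB)]⟩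
        · exact Or.inr ⟨e.symm j, by rw [Equiv.apply_symm_apply]⟩
    rw [G.unrKer_eq_topologicalClosure_map_normalClosure hι.dense xs hx, hrange]
  -- the Tietze data in the three orientations and the images of the three vertex generating sets
  obtain ⟨ē₀, ēm, ē₁, h00, h0m, h01, hmm, hm0, hm1, h11, h10, h1m⟩ :=
    exists_coprod_chain_pinned g₀ gm g2 r s₁ s₂ εA η hεA hη
  set H₀ : Subgroup (PuncturedSurfaceGroup (g₀ + (gm + g2)) r) := Subgroup.closure {x |
      (∃ i : Fin (g₀ + (gm + g2)), (i : ℕ) < g₀ ∧ (x = a i ∨ x = b i)) ∨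
        ∃ j : Fin r, s₂ ≤ (j : ℕ) ∧ x = c j} with hH₀def
  set Hm : Subgroup (PuncturedSurfaceGroup (g₀ + (gm + g2)) r) := Subgroup.closure {x |
      (∃ i : Fin (g₀ + (gm + g2)), (g₀ ≤ (i : ℕ) ∧ (i : ℕ) < g₀ + gm) ∧ (x = a i ∨ x = b i)) ∨
        (∃ j : Fin r, (s₁ ≤ (j : ℕ) ∧ (j : ℕ) < s₂) ∧ x = c j) ∨ x = εA ∨ x = η} with hHmdef
  set H₁ : Subgroup (PuncturedSurfaceGroup (g₀ + (gm + g2)) r) := Subgroup.closure {x |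
      (∃ i : Fin (g₀ + (gm + g2)), g₀ + gm ≤ (i : ℕ) ∧ (x = a i ∨ x = b i)) ∨
        (∃ j : Fin r, (j : ℕ) < s₁ ∧ x = c j) ∨ x = η} with hH₁def
  -- alive images: the first factor of the corresponding orientation
  have hH₀A : H₀.map (QuotientGroup.mk' K) = (ē₀.toMonoidHom.comp Coprod.inl).range :=
    map_mk_closure_v0_eq_range (g₁ := gm + g2) s₂ K hcK _ fun i bit => h00 i bit
  have hHmA : Hm.map (QuotientGroup.mk' K) = (ēm.toMonoidHom.comp Coprod.inl).range :=
    map_mk_closure_chainMid_eq_range hcK hεK hηK _ fun j bit => hmm j bit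
  have hH₁A : H₁.map (QuotientGroup.mk' K) = (ē₁.toMonoidHom.comp Coprod.inl).range :=
    map_mk_closure_chainLast_eq_range hcK hηK _ fun k bit => h11 k bit
  -- killed images: inside the second factor
  have hHm0 : Hm.map (QuotientGroup.mk' K) ≤ (ē₀.toMonoidHom.comp Coprod.inr).range := by
    rw [map_mk_closure_chainMid_eq_range hcK hεK hηK
      (ē₀.toMonoidHom.comp ((Coprod.inr).comp Coprod.inl)) fun j bit => h0m j bit]
    rintro _ ⟨y, rfl⟩
    exact ⟨Coprod.inl y, rfl⟩
  have hH10 : H₁.map (QuotientGroup.mk' K) ≤ (ē₀.toMonoidHom.comp Coprod.inr).range := by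
    rw [map_mk_closure_chainLast_eq_range hcK hηK
      (ē₀.toMonoidHom.comp ((Coprod.inr).comp Coprod.inr)) fun k bit => h01 k bit]
    rintro _ ⟨y, rfl⟩
    exact ⟨Coprod.inr y, rfl⟩
  have hH0m : H₀.map (QuotientGroup.mk' K) ≤ (ēm.toMonoidHom.comp Coprod.inr).range := by
    rw [map_mk_closure_v0_eq_range (g₁ := gm + g2) s₂ K hcK
      (ēm.toMonoidHom.comp ((Coprod.inr).comp Coprod.inl)) fun i bit => hm0 i bit]
    rintro _ ⟨y, rfl⟩
    exact ⟨Coprod.inl y, rfl⟩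
  have hH1m : H₁.map (QuotientGroup.mk' K) ≤ (ēm.toMonoidHom.comp Coprod.inr).range := by
    rw [map_mk_closure_chainLast_eq_range hcK hηK
      (ēm.toMonoidHom.comp ((Coprod.inr).comp Coprod.inr)) fun k bit => hm1 k bit]
    rintro _ ⟨y, rfl⟩
    exact ⟨Coprod.inr y, rfl⟩
  have hH01 : H₀.map (QuotientGroup.mk' K) ≤ (ē₁.toMonoidHom.comp Coprod.inr).range := by
    rw [map_mk_closure_v0_eq_range (g₁ := gm + g2) s₂ K hcK
      (ē₁.toMonoidHom.comp ((Coprod.inr).comp Coprod.inl)) fun i bit => h10 i bit]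
    rintro _ ⟨y, rfl⟩
    exact ⟨Coprod.inl y, rfl⟩
  have hHm1 : Hm.map (QuotientGroup.mk' K) ≤ (ē₁.toMonoidHom.comp Coprod.inr).range := by
    rw [map_mk_closure_chainMid_eq_range hcK hεK hηK
      (ē₁.toMonoidHom.comp ((Coprod.inr).comp Coprod.inr)) fun j bit => h1m j bit]
    rintro _ ⟨y, rfl⟩
    exact ⟨Coprod.inr y, rfl⟩
  -- the level `N = ι⁻¹(V)`, `m = [Γ : N]`, the modulus `n = ℓ^m ∤ m`
  haveI hNfi : (V.comap ι).FiniteIndex := finiteIndex_comap hι V hVo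
  have hm : 0 < (V.comap ι).index := Nat.pos_of_ne_zero Subgroup.FiniteIndex.index_ne_zero
  haveI : NeZero (ℓ ^ (V.comap ι).index) := ⟨(pow_pos hℓ.pos _).ne'⟩
  have hnm : ¬ ℓ ^ (V.comap ι).index ∣ (V.comap ι).index := fun h =>
    absurd (Nat.le_of_dvd hm h) (not_le.mpr (Nat.lt_pow_self hℓ.one_lt))
  -- witnesses: `a^m` for the first handle of each component, and characters seeing them
  obtain ⟨ψ₀, hψ₀, hcard⟩ := exists_handleCharacter_pow_ne_one (g := g₀) (by omega) (V.comap ι).index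
    (ℓ ^ (V.comap ι).index) hnm
  obtain ⟨ψm, hψm, -⟩ := exists_handleCharacter_pow_ne_one (g := gm) (by omega) (V.comap ι).index
    (ℓ ^ (V.comap ι).index) hnm
  obtain ⟨ψ₁, hψ₁, -⟩ := exists_handleCharacter_pow_ne_one (g := g2) (by omega) (V.comap ι).index
    (ℓ ^ (V.comap ι).index) hnm
  have ha₀N : a (r := r) (Fin.castAdd (gm + g2) ⟨0, by omega⟩) ^ (V.comap ι).index ∈ V.comap ι :=
    (V.comap ι).pow_index_mem _
  have hamN : a (r := r) (Fin.natAdd g₀ (Fin.castAdd g2 ⟨0, by omega⟩)) ^ (V.comap ι).index ∈ V.comap ι :=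
    (V.comap ι).pow_index_mem _
  have ha₁N : a (r := r) (Fin.natAdd g₀ (Fin.natAdd gm ⟨0, by omega⟩)) ^ (V.comap ι).index ∈ V.comap ι :=
    (V.comap ι).pow_index_mem _
  have ha₀H : a (r := r) (Fin.castAdd (gm + g2) ⟨0, by omega⟩) ^ (V.comap ι).index ∈ H₀ :=
    H₀.pow_mem (Subgroup.subset_closure (Or.inl ⟨Fin.castAdd (gm + g2) ⟨0, by omega⟩,
      by simp only [Fin.val_castAdd]; omega, Or.inl rfl⟩)) _
  have hamH : a (r := r) (Fin.natAdd g₀ (Fin.castAdd g2 ⟨0, by omega⟩)) ^ (V.comap ι).index ∈ Hm :=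
    Hm.pow_mem (Subgroup.subset_closure (Or.inl ⟨Fin.natAdd g₀ (Fin.castAdd g2 ⟨0, by omega⟩),
      ⟨by simp only [Fin.val_natAdd, Fin.val_castAdd]; omega,
        by simp only [Fin.val_natAdd, Fin.val_castAdd]; omega⟩, Or.inl rfl⟩)) _
  have ha₁H : a (r := r) (Fin.natAdd g₀ (Fin.natAdd gm ⟨0, by omega⟩)) ^ (V.comap ι).index ∈ H₁ :=
    H₁.pow_mem (Subgroup.subset_closure (Or.inl ⟨Fin.natAdd g₀ (Fin.natAdd gm ⟨0, by omega⟩),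
      by simp only [Fin.val_natAdd]; omega, Or.inl rfl⟩)) _
  have hα₀ : QuotientGroup.mk' K (a (r := r) (Fin.castAdd (gm + g2) ⟨0, by omega⟩) ^ (V.comap ι).index) =
      ē₀ (Coprod.inl (a ⟨0, by omega⟩ ^ (V.comap ι).index)) := by
    rw [map_pow, map_pow, map_pow, QuotientGroup.mk'_apply]
    exact congrArg (· ^ (V.comap ι).index) (h00 ⟨0, by omega⟩ false).symm
  have hαm : QuotientGroup.mk' K (a (r := r) (Fin.natAdd g₀ (Fin.castAdd g2 ⟨0, by omega⟩)) ^ (V.comap ι).index) =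
      ēm (Coprod.inl (a ⟨0, by omega⟩ ^ (V.comap ι).index)) := by
    rw [map_pow, map_pow, map_pow, QuotientGroup.mk'_apply]
    exact congrArg (· ^ (V.comap ι).index) (hmm ⟨0, by omega⟩ false).symm
  have hα₁ : QuotientGroup.mk' K (a (r := r) (Fin.natAdd g₀ (Fin.natAdd gm ⟨0, by omega⟩)) ^ (V.comap ι).index) =
      ē₁ (Coprod.inl (a ⟨0, by omega⟩ ^ (V.comap ι).index)) := by
    rw [map_pow, map_pow, map_pow, QuotientGroup.mk'_apply]
    exact congrArg (· ^ (V.comap ι).index) (h11 ⟨0, by omega⟩ false).symm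
  -- bookkeeping shared by the nine cases
  have hS : ∀ U' : Subgroup (V.comap ι), U'.index ∣ Nat.card (Multiplicative (ZMod (ℓ ^ (V.comap ι).index))) →
      U'.FiniteIndex → IsSigmaInteger Sigma U'.index := fun U' h hf =>
    ⟨Nat.pos_of_ne_zero hf.index_ne_zero, fun _ hp hpn =>
      ((Nat.prime_dvd_prime_iff_eq hp hℓ).mp (hp.dvd_of_dvd_pow (hpn.trans (hcard ▸ h)))) ▸ hℓS⟩
  have hwit : ∀ (f : PuncturedSurfaceGroup (g₀ + (gm + g2)) r)
      (H : Subgroup (PuncturedSurfaceGroup (g₀ + (gm + g2)) r))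
      (x : PuncturedSurfaceGroup (g₀ + (gm + g2)) r), x ∈ H → x ∈ V.comap ι →
      f * x * f⁻¹ ∈ (ConjAct.toConjAct f • H) ⊓ V.comap ι := fun f H x hx hxN => by
    refine ⟨?_, (inferInstance : (V.comap ι).Normal).conj_mem x hxN f⟩
    have hfx : f * x * f⁻¹ = ConjAct.toConjAct f • x := by
      rw [ConjAct.smul_def, ConjAct.ofConjAct_toConjAct]
    rw [hfx]
    exact Subgroup.smul_mem_pointwise_smul _ _ _ hx
  refine ⟨V, hVn, hVo, le_rfl, fun w₁ w₂ γ₁ γ₂ hdc => ?_⟩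
  rcases hV w₁ with rfl | rfl | rfl <;> rcases hV w₂ with rfl | rfl | rfl
  · -- `v₀ / v₀`
    refine exists_open_unrSeparating_same hι H₀ K _ _ hV₀ hKer V hVo γ₁ γ₂
      (hdc.resolve_left fun h => h rfl) fun f₁ f₂ hf => ?_
    obtain ⟨U', hU'n, hidx, hfi, hnot, hle⟩ :=
      exists_normal_separating_sameFactor K ē₀ H₀ hH₀A (V.comap ι) ψ₀ ha₀N hα₀ hψ₀ hf
    exact ⟨U', hU'n, hS U' hidx hfi, hle, _, hwit f₁ H₀ _ ha₀H ha₀N, hnot⟩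
  · -- alive `v₀`, killed `v_mid`
    refine exists_open_unrSeparating_cross hι H₀ Hm K _ _ _ hV₀ hVm hKer V hVo γ₁ γ₂ fun f₁ f₂ => ?_
    obtain ⟨U', hU'n, hidx, hfi, hnot, hle⟩ :=
      exists_normal_separating_crossFactor_of_le K ē₀ Hm hHm0 (V.comap ι) ψ₀ hα₀ hψ₀ f₁ f₂
    exact ⟨U', hU'n, hS U' hidx hfi, hle, _, hwit f₁ H₀ _ ha₀H ha₀N, hnot⟩
  · -- alive `v₀`, killed `v₁`
    refine exists_open_unrSeparating_cross hι H₀ H₁ K _ _ _ hV₀ hV₁ hKer V hVo γ₁ γ₂ fun f₁ f₂ => ?_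
    obtain ⟨U', hU'n, hidx, hfi, hnot, hle⟩ :=
      exists_normal_separating_crossFactor_of_le K ē₀ H₁ hH10 (V.comap ι) ψ₀ hα₀ hψ₀ f₁ f₂
    exact ⟨U', hU'n, hS U' hidx hfi, hle, _, hwit f₁ H₀ _ ha₀H ha₀N, hnot⟩
  · -- alive `v_mid`, killed `v₀`
    refine exists_open_unrSeparating_cross hι Hm H₀ K _ _ _ hVm hV₀ hKer V hVo γ₁ γ₂ fun f₁ f₂ => ?_
    obtain ⟨U', hU'n, hidx, hfi, hnot, hle⟩ :=
      exists_normal_separating_crossFactor_of_le K ēm H₀ hH0m (V.comap ι) ψm hαm hψm f₁ f₂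
    exact ⟨U', hU'n, hS U' hidx hfi, hle, _, hwit f₁ Hm _ hamH hamN, hnot⟩
  · -- `v_mid / v_mid`
    refine exists_open_unrSeparating_same hι Hm K _ _ hVm hKer V hVo γ₁ γ₂
      (hdc.resolve_left fun h => h rfl) fun f₁ f₂ hf => ?_
    obtain ⟨U', hU'n, hidx, hfi, hnot, hle⟩ :=
      exists_normal_separating_sameFactor K ēm Hm hHmA (V.comap ι) ψm hamN hαm hψm hf
    exact ⟨U', hU'n, hS U' hidx hfi, hle, _, hwit f₁ Hm _ hamH hamN, hnot⟩
  · -- alive `v_mid`, killed `v₁`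
    refine exists_open_unrSeparating_cross hι Hm H₁ K _ _ _ hVm hV₁ hKer V hVo γ₁ γ₂ fun f₁ f₂ => ?_
    obtain ⟨U', hU'n, hidx, hfi, hnot, hle⟩ :=
      exists_normal_separating_crossFactor_of_le K ēm H₁ hH1m (V.comap ι) ψm hαm hψm f₁ f₂
    exact ⟨U', hU'n, hS U' hidx hfi, hle, _, hwit f₁ Hm _ hamH hamN, hnot⟩
  · -- alive `v₁`, killed `v₀`
    refine exists_open_unrSeparating_cross hι H₁ H₀ K _ _ _ hV₁ hV₀ hKer V hVo γ₁ γ₂ fun f₁ f₂ => ?_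
    obtain ⟨U', hU'n, hidx, hfi, hnot, hle⟩ :=
      exists_normal_separating_crossFactor_of_le K ē₁ H₀ hH01 (V.comap ι) ψ₁ hα₁ hψ₁ f₁ f₂
    exact ⟨U', hU'n, hS U' hidx hfi, hle, _, hwit f₁ H₁ _ ha₁H ha₁N, hnot⟩
  · -- alive `v₁`, killed `v_mid`
    refine exists_open_unrSeparating_cross hι H₁ Hm K _ _ _ hV₁ hVm hKer V hVo γ₁ γ₂ fun f₁ f₂ => ?_
    obtain ⟨U', hU'n, hidx, hfi, hnot, hle⟩ :=
      exists_normal_separating_crossFactor_of_le K ē₁ Hm hHm1 (V.comap ι) ψ₁ hα₁ hψ₁ f₁ f₂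
    exact ⟨U', hU'n, hS U' hidx hfi, hle, _, hwit f₁ H₁ _ ha₁H ha₁N, hnot⟩
  · -- `v₁ / v₁`
    refine exists_open_unrSeparating_same hι H₁ K _ _ hV₁ hKer V hVo γ₁ γ₂
      (hdc.resolve_left fun h => h rfl) fun f₁ f₂ hf => ?_
    obtain ⟨U', hU'n, hidx, hfi, hnot, hle⟩ :=
      exists_normal_separating_sameFactor K ē₁ H₁ hH₁A (V.comap ι) ψ₁ ha₁N hα₁ hψ₁ hf
    exact ⟨U', hU'n, hS U' hidx hfi, hle, _, hwit f₁ H₁ _ ha₁H ha₁N, hnot⟩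

/-- **The STURDY `Π^unr`-clauses of [CombGC] Prop. 1.2 (i) AND (ii) at every pointed three-component chain
datum** (from the `Π^unr`-separating coverings above by abc-iut-w5-d183's formal steps).
[cite: MochizukiCombGC2007, Prop 1.2 pp.8-9] -/
theorem unrProp12_of_threeChain' (hne : Sigma.Nonempty)
    (hprime : ∀ p ∈ Sigma, p.Prime) (ι : PuncturedSurfaceGroup g r →* P)
    (hι : IsProSigmaCompletion Sigma ι) (G : PSCDatum P) {g₀ g₁ s₁ s₂ : ℕ} (hg : g₀ ≤ g₁) (hg₁ : g₁ ≤ g)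
    (hs₁₂ : s₁ < s₂) (hs₂ : s₂ < r) (e : G.graph.C ≃ Fin r)
    (hC : ∀ c', G.cuspGp c' = ((cuspInertia (g := g) (e c')).map ι).topologicalClosure)
    (v₀ vm v₁ : G.graph.V) (hV : ∀ w, w = v₀ ∨ w = vm ∨ w = v₁) (εA η : PuncturedSurfaceGroup g r)
    (hεA : εA = ((List.finRange r).map fun j : Fin r =>
          if s₂ ≤ (j : ℕ) then PuncturedSurfaceGroup.c (g := g) j else 1).prod *
        ((List.finRange g).map fun i : Fin g => if (i : ℕ) < g₀ then
          PuncturedSurfaceGroup.a (r := r) i * PuncturedSurfaceGroup.b i *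
            (PuncturedSurfaceGroup.a i)⁻¹ * (PuncturedSurfaceGroup.b i)⁻¹ else 1).prod)
    (hη : η = ((List.finRange r).map fun j : Fin r =>
          if s₁ ≤ (j : ℕ) then PuncturedSurfaceGroup.c (g := g) j else 1).prod *
        ((List.finRange g).map fun i : Fin g => if (i : ℕ) < g₁ then
          PuncturedSurfaceGroup.a (r := r) i * PuncturedSurfaceGroup.b i *
            (PuncturedSurfaceGroup.a i)⁻¹ * (PuncturedSurfaceGroup.b i)⁻¹ else 1).prod)
    (hV₀ : G.vertGp v₀ = ((Subgroup.closure {x : PuncturedSurfaceGroup g r |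
        (∃ i : Fin g, (i : ℕ) < g₀ ∧ (x = PuncturedSurfaceGroup.a i ∨ x = PuncturedSurfaceGroup.b i)) ∨
        ∃ j : Fin r, s₂ ≤ (j : ℕ) ∧ x = PuncturedSurfaceGroup.c j}).map ι).topologicalClosure)
    (hVm : G.vertGp vm = ((Subgroup.closure {x : PuncturedSurfaceGroup g r |
        (∃ i : Fin g, (g₀ ≤ (i : ℕ) ∧ (i : ℕ) < g₁) ∧
          (x = PuncturedSurfaceGroup.a i ∨ x = PuncturedSurfaceGroup.b i)) ∨
        (∃ j : Fin r, (s₁ ≤ (j : ℕ) ∧ (j : ℕ) < s₂) ∧ x = PuncturedSurfaceGroup.c j) ∨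
        x = εA ∨ x = η}).map ι).topologicalClosure)
    (hV₁ : G.vertGp v₁ = ((Subgroup.closure {x : PuncturedSurfaceGroup g r |
        (∃ i : Fin g, g₁ ≤ (i : ℕ) ∧ (x = PuncturedSurfaceGroup.a i ∨ x = PuncturedSurfaceGroup.b i)) ∨
        (∃ j : Fin r, (j : ℕ) < s₁ ∧ x = PuncturedSurfaceGroup.c j) ∨ x = η}).map ι).topologicalClosure)
    (nA nB : G.graph.N) (hN : ∀ n, n = nA ∨ n = nB)
    (hEA : G.nodeGp nA = ((Subgroup.zpowers εA).map ι).topologicalClosure)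
    (hEB : G.nodeGp nB = ((Subgroup.zpowers η).map ι).topologicalClosure)
    (hgen₀ : G.genus v₀ = g₀) (hgenm : G.genus vm = g₁ - g₀) (hgen₁ : G.genus v₁ = g - g₁) :
    G.UnrVerticialOpenInterDeterminesVertex ∧ G.UnrVerticialCommensurablyTerminal :=
  have hU := G.unrVerticialSeparatingCoverings_of_threeChain' hne hprime ι hι hg hg₁ hs₁₂ hs₂ e hC v₀ vm v₁
    hV εA η hεA hη hV₀ hVm hV₁ nA nB hN hEA hEB hgen₀ hgenm hgen₁
  ⟨G.unrVerticialOpenInterDeterminesVertex_of_separating hU, G.unrVerticialCommensurablyTerminal_of_separating hU⟩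

end PSCDatum

end Literature.AnabelianGeometry.SemiGraphs

end
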